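import Literature.NumberTheory.Automorphic.GodementJacquetSingularIntegrability
import Literature.NumberTheory.Automorphic.GodementJacquetSingularUnfolding
import Literature.NumberTheory.Automorphic.GodementJacquetSingularOrbitVanishing
import Literature.NumberTheory.Automorphic.GodementJacquetRankOne
import HarnessLib

/-!
# The singular defect of the Godement–Jacquet reflection formula vanishes against cusp forms

Topic `NumberTheory/Automorphic`; namespace `Literature.NumberTheory.Automorphic`. Proof file
(theorems only). The reflection identity `gjZeta_restrict_compl_sub_dual_eq_integral_gjSingDefect`
expresses `Z^{<1}(Φ, s, φ, φ') - λ⁻¹ ∫ F''(g) ⟪φ', R(g)φ⟫ dν` as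
`c ∫ β(x₀) conj φ'([x₀]) ∫ β(y₀) φ([y₀]) (κ ∫_{A_G} (Q' - Q)(x₀, y₀, a) dα) dν(y₀) dν(x₀)`; here we prove
that **the inner `y₀`-integral vanishes for every `x₀`** when `φ` is (a continuous representative
of) a cusp form with the expected analytic properties (`integral_bruhat_mul_singDefect_eq_zero`).
This is Godement–Jacquet (1972), §12 for `n ≥ 2` ("the singular `ξ` contribute nothing because `φ`
is a cusp form"), organised as follows.

* `lintegral_gjWeight_mul_eq` — Tonelli version of the absorption of the central integral
  (`GodementJacquetSingularUnfolding`): `∫ w |F([ỹ⁻¹])| S(ỹ) dν = κ ∫ β(y₀) |F([y₀])| ∫_{A_G} S(a y₀⁻¹)`;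
* `gjThetaSing_eq_apply_zero_add_tsum` — `Θ^sing(A, B) = Φ(0) + Σ_{ξ ∈ T} Φ(A ξ B)`;
  `lintegral_center_tsum_singTermR_le`, `lintegral_center_tsum_singTermL_le` — the `ξ ≠ 0` pieces are
  dominated by the majorants of `GodementJacquetSingularIntegrability`;
* `integrable_bruhat_mul_comp_mk` — `β · F∘π ∈ L¹(G)`;
  `integral_bruhat_mul_tsum_singTermR_eq_zero`, `integral_bruhat_mul_tsum_singTermL_eq_zero` — the
  `ξ ≠ 0` pieces vanish (absorption, then `GodementJacquetSingularOrbitVanishing`);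
* `integral_bruhat_mul_singDefect_eq_zero` — **main**: the `ξ = 0` pieces are constants
  (`c_α/s · Φ(0)`, `-c_α/(n-s) · Φ̂(0)`, `GodementJacquetCenterMellin`) times
  `∫ β F∘π dν = c⁻¹ ∫_X F dμ = 0`, and everything is absolutely convergent a.e. in `y₀`.

## References

* R. Godement, H. Jacquet, *Zeta functions of simple algebras*, LNM 260 (1972), §12
  [GodementJacquetLNM260].
-/

noncomputable section

open MeasureTheory Measure Set Filter Topology IsDedekindDomain NumberField MulAction
open Literature.MeasureTheory.Group Literature.LinearAlgebra.Matrix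
open scoped ENNReal NNReal

namespace Literature.NumberTheory.Automorphic

variable {n : ℕ} {K : Type} [Field K] [NumberField K]

attribute [local instance] adelicBorel borelSpace_adelic locallyCompactSpace_adelic
  secondCountableTopology_gl_adelic measurableSpaceQuotient borelSpaceQuotient glBorel borelSpace_glBorel

attribute [local instance] smulInvariantMeasureQuotient isFiniteMeasureOnCompactsQuotient

/-! ### The `lintegral` version of the absorption of the central integral -/

section LGen

variable (ν : Measure (AdelicGroupData.gl n K).Adelic) [ν.IsHaarMeasure]

/-- **Tonelli version of `integral_bruhat_mul_integral_center_eq`**: for Borel `S ≥ 0` on `G`,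
`∫_G w(ỹ) |F([ỹ⁻¹])| S(ỹ) dν(ỹ) = κ ∫_G β(y₀) |F([y₀])| ∫_{A_G} S(a y₀⁻¹) dα dν(y₀)`,
`w = gjWeight κ α β` (no integrability hypothesis). It converts the absolute-convergence statements
of `GodementJacquetSingularIntegrability` (in the variables `(y₀, a)`) into the hypotheses of
`GodementJacquetSingularOrbitVanishing` (in the variable `ỹ`). [folklore] -/
theorem lintegral_gjWeight_mul_eq {α : Measure (AdelicGroupData.gl n K).center'} [α.IsHaarMeasure] (κ : ℝ≥0)
    {β : (AdelicGroupData.gl n K).Adelic → ℝ} (hβc : Continuous β)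
    {F : (AdelicGroupData.gl n K).Adelic ⧸ (AdelicGroupData.gl n K).quotientSubgroup → ℂ}
    (hFc : Continuous fun y : (AdelicGroupData.gl n K).Adelic => F (QuotientGroup.mk y))
    {S : (AdelicGroupData.gl n K).Adelic → ℝ≥0∞} (hSm : Measurable S) :
    ∫⁻ y, gjWeight κ α β y * ((‖invQuot (AdelicGroupData.gl n K) F y‖ₑ : ℝ≥0∞) * S y) ∂ν =
      κ * ∫⁻ y₀, ENNReal.ofReal (β y₀) * ((‖F (QuotientGroup.mk y₀)‖ₑ : ℝ≥0∞) *
        ∫⁻ a : (AdelicGroupData.gl n K).center', S ((a : (AdelicGroupData.gl n K).Adelic) * y₀⁻¹) ∂α) ∂ν := by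
  haveI : ν.IsMulRightInvariant := GLn.isMulRightInvariant_of_isHaarMeasure_adelic_holds n K ν inferInstance
  haveI : ν.IsInvInvariant := isInvInvariant_of_isHaarMeasure_gl n K ν
  -- the integrand on `G × A_G`
  set f : (AdelicGroupData.gl n K).Adelic → (AdelicGroupData.gl n K).center' → ℝ≥0∞ :=
    fun y₀ a => ENNReal.ofReal (β y₀) * ((‖F (QuotientGroup.mk y₀)‖ₑ : ℝ≥0∞) *
      S ((a : (AdelicGroupData.gl n K).Adelic) * y₀⁻¹)) with hf
  have hβm : Measurable fun y : (AdelicGroupData.gl n K).Adelic => ENNReal.ofReal (β y) :=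
    hβc.measurable.ennreal_ofReal
  have hact : Measurable fun p : (AdelicGroupData.gl n K).Adelic × (AdelicGroupData.gl n K).center' =>
      (p.2 : (AdelicGroupData.gl n K).Adelic) * p.1⁻¹ :=
    ((continuous_subtype_val.comp continuous_snd).mul continuous_fst.inv).measurable
  have hFm : Measurable fun y : (AdelicGroupData.gl n K).Adelic => (‖F (QuotientGroup.mk y)‖ₑ : ℝ≥0∞) :=
    hFc.measurable.enorm
  have hfm : Measurable (Function.uncurry f) :=
    (hβm.comp measurable_fst).mul ((hFm.comp measurable_fst).mul (hSm.comp hact))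
  have hSa : ∀ y₀ : (AdelicGroupData.gl n K).Adelic, Measurable fun a : (AdelicGroupData.gl n K).center' =>
      S ((a : (AdelicGroupData.gl n K).Adelic) * y₀⁻¹) := fun y₀ =>
    hSm.comp ((continuous_subtype_val.mul continuous_const).measurable)
  -- Step 1: constants inside
  have h1 : ∫⁻ y₀, ENNReal.ofReal (β y₀) * ((‖F (QuotientGroup.mk y₀)‖ₑ : ℝ≥0∞) *
      ∫⁻ a : (AdelicGroupData.gl n K).center', S ((a : (AdelicGroupData.gl n K).Adelic) * y₀⁻¹) ∂α) ∂ν =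
      ∫⁻ y₀, ∫⁻ a, f y₀ a ∂α ∂ν := by
    refine lintegral_congr fun y₀ => ?_
    simp only [hf]
    rw [lintegral_const_mul _ ((hSa y₀).const_mul _), lintegral_const_mul _ (hSa y₀)]
  -- Step 2/3: Tonelli and `y₀ ↦ y₀ a`
  set g : (AdelicGroupData.gl n K).center' → (AdelicGroupData.gl n K).Adelic → ℝ≥0∞ :=
    fun a y₀ => ENNReal.ofReal (β (y₀ * (a : (AdelicGroupData.gl n K).Adelic))) *
      ((‖F (QuotientGroup.mk y₀)‖ₑ : ℝ≥0∞) * S y₀⁻¹) with hg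
  have hfg : ∀ (a : (AdelicGroupData.gl n K).center') (y₀ : (AdelicGroupData.gl n K).Adelic),
      f (y₀ * (a : (AdelicGroupData.gl n K).Adelic)) a = g a y₀ := by
    intro a y₀
    simp only [hf, hg]
    have hmk : (QuotientGroup.mk (y₀ * (a : (AdelicGroupData.gl n K).Adelic)) :
        (AdelicGroupData.gl n K).Adelic ⧸ (AdelicGroupData.gl n K).quotientSubgroup) = QuotientGroup.mk y₀ :=
      QuotientGroup.mk_mul_of_mem y₀ ((AdelicGroupData.gl n K).center'_le_quotientSubgroup a.2)
    have hinv : (a : (AdelicGroupData.gl n K).Adelic) * (y₀ * (a : (AdelicGroupData.gl n K).Adelic))⁻¹ = y₀⁻¹ := by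
      rw [mul_inv_rev, mul_inv_cancel_left]
    rw [hmk, hinv]
  have h2 : ∫⁻ y₀, ∫⁻ a, f y₀ a ∂α ∂ν = ∫⁻ a, ∫⁻ y₀, g a y₀ ∂ν ∂α := by
    rw [lintegral_lintegral_swap hfm.aemeasurable]
    refine lintegral_congr fun a => ?_
    rw [← lintegral_mul_right_eq_self (fun y₀ => f y₀ a) (a : (AdelicGroupData.gl n K).Adelic)]
    exact lintegral_congr fun y₀ => hfg a y₀
  -- Step 4: Tonelli back
  have hgm : Measurable (Function.uncurry g) := by
    have he : Measurable fun p : (AdelicGroupData.gl n K).center' × (AdelicGroupData.gl n K).Adelic =>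
        (p.2 * (p.1 : (AdelicGroupData.gl n K).Adelic), p.1) :=
      ((continuous_snd.mul (continuous_subtype_val.comp continuous_fst)).prodMk continuous_fst).measurable
    have : Function.uncurry g = Function.uncurry f ∘ fun p : (AdelicGroupData.gl n K).center' × (AdelicGroupData.gl n K).Adelic =>
        (p.2 * (p.1 : (AdelicGroupData.gl n K).Adelic), p.1) := by
      funext p
      simp only [Function.comp_apply, Function.uncurry_apply_pair]
      exact (hfg p.1 p.2).symm
    rw [this]
    exact hfm.comp he
  have h4 : ∫⁻ a, ∫⁻ y₀, g a y₀ ∂ν ∂α = ∫⁻ y₀, ∫⁻ a, g a y₀ ∂α ∂ν :=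
    lintegral_lintegral_swap hgm.aemeasurable
  -- Step 5: inner `A_G`-integral
  have hβa : ∀ y₀ : (AdelicGroupData.gl n K).Adelic, Measurable fun a : (AdelicGroupData.gl n K).center' =>
      ENNReal.ofReal (β (y₀ * (a : (AdelicGroupData.gl n K).Adelic))) := fun y₀ =>
    (hβc.comp (continuous_const.mul continuous_subtype_val)).measurable.ennreal_ofReal
  have h5 : ∀ y₀ : (AdelicGroupData.gl n K).Adelic, ∫⁻ a, g a y₀ ∂α =
      (∫⁻ a : (AdelicGroupData.gl n K).center', ENNReal.ofReal (β (y₀ * (a : (AdelicGroupData.gl n K).Adelic))) ∂α) *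
        ((‖F (QuotientGroup.mk y₀)‖ₑ : ℝ≥0∞) * S y₀⁻¹) := fun y₀ => by
    simp only [hg]
    rw [lintegral_mul_const _ (hβa y₀)]
  rw [h1, h2, h4]
  simp_rw [h5]
  -- Step 6: `y₀ ↦ y₀⁻¹`
  rw [← lintegral_inv_eq_self (μ := ν) (fun y₀ : (AdelicGroupData.gl n K).Adelic =>
    (∫⁻ a : (AdelicGroupData.gl n K).center', ENNReal.ofReal (β (y₀ * (a : (AdelicGroupData.gl n K).Adelic))) ∂α) *
      ((‖F (QuotientGroup.mk y₀)‖ₑ : ℝ≥0∞) * S y₀⁻¹))]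
  simp only [inv_inv]
  -- Step 7: `κ ∫ β(y⁻¹ a) dα = w(y)`
  rw [← lintegral_const_mul' _ _ ENNReal.coe_ne_top]
  refine lintegral_congr fun y => ?_
  rw [gjWeight_apply, mul_assoc]
  rfl

end LGen

/-! ### Splitting the singular theta series: `Θ^sing = Φ(0) + Σ_{ξ ∈ T}` -/

section Split

omit [NumberField K] in
/-- `0` is not a unit in `M_n(K)` for `n ≥ 1`. [folklore] -/
theorem not_isUnit_zero_matrix (hn : 0 < n) : ¬ IsUnit (0 : Matrix (Fin n) (Fin n) K) := by
  haveI : Nonempty (Fin n) := ⟨⟨0, hn⟩⟩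
  rw [isUnit_zero_iff]
  exact zero_ne_one

/-- **`Θ_Φ^sing(A, B) = Φ(0) + Σ_{ξ ∈ T} Φ(A ξ B)`** (`T` the non-zero singular matrices; the series is
absolutely convergent). [folklore] -/
theorem gjThetaSing_eq_apply_zero_add_tsum (hn : 0 < n) {Φ : Matrix (Fin n) (Fin n) (AdeleRing (𝓞 K) K) → ℂ}
    (hΦ : Φ ∈ schwartzBruhatAdelicMatrix n K) (A B : GL (Fin n) (AdeleRing (𝓞 K) K)) :
    gjThetaSing n K Φ A B = Φ 0 + ∑' ξ : SingR n K,
      Φ ((A : Matrix (Fin n) (Fin n) (AdeleRing (𝓞 K) K)) * ratMatrix n K ξ.1 * (B : Matrix (Fin n) (Fin n) (AdeleRing (𝓞 K) K))) := by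
  set f : Matrix (Fin n) (Fin n) K → ℂ := fun ξ =>
    Φ ((A : Matrix (Fin n) (Fin n) (AdeleRing (𝓞 K) K)) * ratMatrix n K ξ * (B : Matrix (Fin n) (Fin n) (AdeleRing (𝓞 K) K))) with hf
  have hsum : Summable f := (summable_norm_gjThetaTerm hΦ A B).of_norm
  set S : Set (Matrix (Fin n) (Fin n) K) := {ξ | ¬ IsUnit ξ} with hS
  set T : Set (Matrix (Fin n) (Fin n) K) := {ξ | ¬ IsUnit ξ ∧ ξ ≠ 0} with hT
  have hsplit : S.indicator f = ({(0 : Matrix (Fin n) (Fin n) K)} : Set _).indicator f + T.indicator f := by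
    funext ξ
    simp only [Pi.add_apply]
    by_cases h0 : ξ = 0
    · subst h0
      rw [indicator_of_mem (show (0 : Matrix (Fin n) (Fin n) K) ∈ S from not_isUnit_zero_matrix hn),
        indicator_of_mem (mem_singleton _), indicator_of_notMem (fun h => h.2 rfl), add_zero]
    · rw [indicator_of_notMem (show ξ ∉ ({0} : Set _) from h0), zero_add]
      by_cases hu : IsUnit ξ
      · rw [indicator_of_notMem (show ξ ∉ S from fun h => h hu), indicator_of_notMem (show ξ ∉ T from fun h => h.1 hu)]
      · rw [indicator_of_mem (show ξ ∈ S from hu), indicator_of_mem (show ξ ∈ T from ⟨hu, h0⟩)]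
  have h1 : gjThetaSing n K Φ A B = ∑' ξ, S.indicator f ξ := tsum_subtype S f
  have h2 : (∑' ξ : SingR n K, Φ ((A : Matrix (Fin n) (Fin n) (AdeleRing (𝓞 K) K)) * ratMatrix n K ξ.1 *
      (B : Matrix (Fin n) (Fin n) (AdeleRing (𝓞 K) K)))) = ∑' ξ, T.indicator f ξ := tsum_subtype T f
  have h3 : ∑' ξ, ({(0 : Matrix (Fin n) (Fin n) K)} : Set _).indicator f ξ = Φ 0 := by
    refine (tsum_eq_single (0 : Matrix (Fin n) (Fin n) K) fun ξ hξ =>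
      indicator_of_notMem (show ξ ∉ ({(0 : Matrix (Fin n) (Fin n) K)} : Set _) from hξ) f).trans ?_
    rw [indicator_of_mem (mem_singleton _)]
    have h0 : ratMatrix n K (0 : Matrix (Fin n) (Fin n) K) = 0 := by
      ext i j; simp [ratMatrix]
    simp only [hf, h0, Matrix.mul_zero, Matrix.zero_mul]
  rw [h1, h2, hsplit]
  show ∑' ξ, (({(0 : Matrix (Fin n) (Fin n) K)} : Set _).indicator f ξ + T.indicator f ξ) = _
  rw [(hsum.indicator _).tsum_add (hsum.indicator _), h3]

/-- The same splitting read with `SingL` (same underlying set). [folklore] -/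
theorem gjThetaSing_eq_apply_zero_add_tsum' (hn : 0 < n) {Φ : Matrix (Fin n) (Fin n) (AdeleRing (𝓞 K) K) → ℂ}
    (hΦ : Φ ∈ schwartzBruhatAdelicMatrix n K) (A B : GL (Fin n) (AdeleRing (𝓞 K) K)) :
    gjThetaSing n K Φ A B = Φ 0 + ∑' ξ : SingL n K,
      Φ ((A : Matrix (Fin n) (Fin n) (AdeleRing (𝓞 K) K)) * ratMatrix n K ξ.1 * (B : Matrix (Fin n) (Fin n) (AdeleRing (𝓞 K) K))) :=
  gjThetaSing_eq_apply_zero_add_tsum hn hΦ A B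

/-- `|Θ^sing| ≤ Σ_{all ξ} |Φ(A ξ B)|`. [folklore] -/
theorem enorm_tsum_singR_le {Φ : Matrix (Fin n) (Fin n) (AdeleRing (𝓞 K) K) → ℂ} (A B : GL (Fin n) (AdeleRing (𝓞 K) K)) :
    ∑' ξ : SingR n K, (‖Φ ((A : Matrix (Fin n) (Fin n) (AdeleRing (𝓞 K) K)) * ratMatrix n K ξ.1 *
        (B : Matrix (Fin n) (Fin n) (AdeleRing (𝓞 K) K)))‖ₑ : ℝ≥0∞) ≤
      ∑' ξ : Matrix (Fin n) (Fin n) K, (‖Φ ((A : Matrix (Fin n) (Fin n) (AdeleRing (𝓞 K) K)) * ratMatrix n K ξ *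
        (B : Matrix (Fin n) (Fin n) (AdeleRing (𝓞 K) K)))‖ₑ : ℝ≥0∞) :=
  ENNReal.tsum_comp_le_tsum_of_injective Subtype.val_injective
    (fun ξ : Matrix (Fin n) (Fin n) K => (‖Φ ((A : Matrix (Fin n) (Fin n) (AdeleRing (𝓞 K) K)) * ratMatrix n K ξ *
        (B : Matrix (Fin n) (Fin n) (AdeleRing (𝓞 K) K)))‖ₑ : ℝ≥0∞))

/-- `Σ_{ξ ∈ T} |Φ(A ξ B)| ≤ Σ_{all ξ} |Φ(A ξ B)|` (left copy). [folklore] -/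
theorem enorm_tsum_singL_le {Φ : Matrix (Fin n) (Fin n) (AdeleRing (𝓞 K) K) → ℂ} (A B : GL (Fin n) (AdeleRing (𝓞 K) K)) :
    ∑' ξ : SingL n K, (‖Φ ((A : Matrix (Fin n) (Fin n) (AdeleRing (𝓞 K) K)) * ratMatrix n K ξ.1 *
        (B : Matrix (Fin n) (Fin n) (AdeleRing (𝓞 K) K)))‖ₑ : ℝ≥0∞) ≤
      ∑' ξ : Matrix (Fin n) (Fin n) K, (‖Φ ((A : Matrix (Fin n) (Fin n) (AdeleRing (𝓞 K) K)) * ratMatrix n K ξ *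
        (B : Matrix (Fin n) (Fin n) (AdeleRing (𝓞 K) K)))‖ₑ : ℝ≥0∞) :=
  ENNReal.tsum_comp_le_tsum_of_injective Subtype.val_injective
    (fun ξ : Matrix (Fin n) (Fin n) K => (‖Φ ((A : Matrix (Fin n) (Fin n) (AdeleRing (𝓞 K) K)) * ratMatrix n K ξ *
        (B : Matrix (Fin n) (Fin n) (AdeleRing (𝓞 K) K)))‖ₑ : ℝ≥0∞))

end Split

/-! ### The singular terms against the majorants -/

section Majorants

variable {α : Measure (AdelicGroupData.gl n K).center'}

/-- `∫_{A_G} Σ_{ξ ∈ T} |F₁(x₀ a y₀⁻¹) Φ(x₀ ξ a y₀⁻¹)| dα ≤ K_T(x₀, y₀)`. [folklore] -/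
theorem lintegral_center_tsum_singTermR_le (x₀ : (AdelicGroupData.gl n K).Adelic) (s : ℂ)
    (Φ : Matrix (Fin n) (Fin n) (AdeleRing (𝓞 K) K) → ℂ) (y₀ : (AdelicGroupData.gl n K).Adelic) :
    ∫⁻ a : (AdelicGroupData.gl n K).center', ∑' ξ : SingR n K,
        (‖singTermR x₀ s Φ ((a : (AdelicGroupData.gl n K).Adelic) * y₀⁻¹) ξ‖ₑ : ℝ≥0∞) ∂α ≤
      truncThetaMajorant Φ s x₀ α y₀ := by
  refine lintegral_mono fun a => ?_
  simp only [singTermR, enorm_mul]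
  rw [ENNReal.tsum_mul_left, ← mul_assoc x₀]
  exact mul_le_mul_right (enorm_tsum_singR_le _ _) _

/-- `∫_{A_G} Σ_{ξ ∈ T} |F''((a y₀⁻¹)⁻¹ x₀⁻¹) Ψ((a y₀⁻¹)⁻¹ ξ x₀⁻¹)| dα ≤ K_D(x₀, y₀)` (`α` inversion
invariant: the dual majorant is written with `a` in place of `a⁻¹`). [folklore] -/
theorem lintegral_center_tsum_singTermL_le [α.IsInvInvariant] (x₀ : (AdelicGroupData.gl n K).Adelic) (s : ℂ)
    (Ψ : Matrix (Fin n) (Fin n) (AdeleRing (𝓞 K) K) → ℂ) (y₀ : (AdelicGroupData.gl n K).Adelic) :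
    ∫⁻ a : (AdelicGroupData.gl n K).center', ∑' ξ : SingL n K,
        (‖singTermL x₀ s Ψ ((a : (AdelicGroupData.gl n K).Adelic) * y₀⁻¹) ξ‖ₑ : ℝ≥0∞) ∂α ≤
      dualThetaMajorant Ψ s x₀ α y₀ := by
  unfold dualThetaMajorant
  rw [← lintegral_inv_eq_self (μ := α) (fun a : (AdelicGroupData.gl n K).center' =>
    (‖gjDualF n K (fun _ => (1 : ℂ)) ((n : ℂ) - s) (y₀ * (a : (AdelicGroupData.gl n K).Adelic) * x₀⁻¹)‖ₑ : ℝ≥0∞) *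
      ∑' ξ : Matrix (Fin n) (Fin n) K,
        (‖Ψ (Units.val ((y₀ * (a : (AdelicGroupData.gl n K).Adelic) : (AdelicGroupData.gl n K).Adelic)) *
          ratMatrix n K ξ * (Units.val (x₀⁻¹ : (AdelicGroupData.gl n K).Adelic)))‖ₑ : ℝ≥0∞))]
  refine lintegral_mono fun a => ?_
  have hinv : ((a : (AdelicGroupData.gl n K).Adelic) * y₀⁻¹)⁻¹ = y₀ * ((a⁻¹ : (AdelicGroupData.gl n K).center') :
      (AdelicGroupData.gl n K).Adelic) := by
    rw [mul_inv_rev, inv_inv, Subgroup.coe_inv]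
  simp only [singTermL, enorm_mul, hinv]
  rw [ENNReal.tsum_mul_left]
  exact mul_le_mul_right (enorm_tsum_singL_le _ _) _

end Majorants


/-! ### Integrability of `β · F∘π` and the vanishing of the `ξ ≠ 0` pieces -/

section Pieces

variable (μ : Measure (AdelicGroupData.gl n K).automorphicQuotient)
  [(AdelicGroupData.gl n K).IsAutomorphicMeasure μ]
  (ν : Measure (AdelicGroupData.gl n K).Adelic) [ν.IsHaarMeasure]

/-- `y ↦ β(y) F([y])` is integrable for `F ∈ L¹(X)` continuous and `β` a Bruhat function, with
`∫ β |F ∘ π| dν = c⁻¹ ∫ |F| dμ`. [folklore] -/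
theorem integrable_bruhat_mul_comp_mk
    {β : (AdelicGroupData.gl n K).Adelic → ℝ}
    (hβ : IsBruhatFunction (AdelicGroupData.gl n K).quotientSubgroup (quotientSubgroupHaar n K) β)
    {F : (AdelicGroupData.gl n K).automorphicQuotient → ℂ} (hFX : Continuous F) (hFint : Integrable F μ) :
    Integrable (fun y : (AdelicGroupData.gl n K).Adelic => (β y : ℂ) * F (QuotientGroup.mk y)) ν ∧
      ∫⁻ y, ENNReal.ofReal (β y) * (‖F (QuotientGroup.mk y)‖ₑ : ℝ≥0∞) ∂ν < ⊤ := by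
  have hmk : Continuous fun y : (AdelicGroupData.gl n K).Adelic => F (QuotientGroup.mk y) :=
    hFX.comp (AdelicGroupData.gl n K).continuous_toAutomorphicQuotient
  have hlin : ∫⁻ y, ENNReal.ofReal (β y) * (‖F (QuotientGroup.mk y)‖ₑ : ℝ≥0∞) ∂ν < ⊤ := by
    have h := hβ.lintegral_eq_mul_lintegral (AdelicGroupData.gl n K).quotientSubgroup (quotientSubgroupHaar n K) μ ν
      (u := fun x => (‖F x‖ₑ : ℝ≥0∞)) hFX.measurable.enorm
    have hc : unfoldingConstant (AdelicGroupData.gl n K).quotientSubgroup (quotientSubgroupHaar n K) μ ν ≠ 0 :=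
      (automorphicUnfoldingConstant_pos n K μ ν).ne'
    have hfin : ∫⁻ x, (‖F x‖ₑ : ℝ≥0∞) ∂μ < ⊤ := hFint.2
    have h' : ∫⁻ x, (‖F x‖ₑ : ℝ≥0∞) ∂μ =
        (unfoldingConstant (AdelicGroupData.gl n K).quotientSubgroup (quotientSubgroupHaar n K) μ ν : ℝ≥0∞) *
          ∫⁻ y, ENNReal.ofReal (β y) * (‖F (QuotientGroup.mk y)‖ₑ : ℝ≥0∞) ∂ν := h
    rw [h'] at hfin
    exact ENNReal.lt_top_of_mul_ne_top_right hfin.ne (ENNReal.coe_ne_zero.2 hc)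
  refine ⟨⟨((Complex.continuous_ofReal.comp hβ.continuous).mul hmk).aestronglyMeasurable, ?_⟩, hlin⟩
  rw [HasFiniteIntegral]
  refine lt_of_le_of_lt (lintegral_mono fun y => le_of_eq ?_) hlin
  rw [enorm_mul, ← ofReal_norm (β y : ℂ), Complex.norm_real, Real.norm_of_nonneg (hβ.nonneg _)]


/-- **The `Φ`-side `ξ ≠ 0` piece vanishes**:
`∫ β(y₀) F([y₀]) ∫_{A_G} Σ_{ξ ∈ T} F₁(x₀ a y₀⁻¹) Φ(x₀ ξ a y₀⁻¹) dα dν(y₀) = 0` under the finiteness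
of the truncated majorant integral (`GodementJacquetSingularIntegrability`): absorb the central
integral (`integral_bruhat_mul_integral_center_eq`), then `integral_wt_mul_tsum_singTermR_eq_zero`,
whose absolute-convergence hypothesis is supplied by `lintegral_gjWeight_mul_eq`. [folklore] -/
theorem integral_bruhat_mul_tsum_singTermR_eq_zero (x₀ : (AdelicGroupData.gl n K).Adelic) (s : ℂ)
    {Φ : Matrix (Fin n) (Fin n) (AdeleRing (𝓞 K) K) → ℂ} (hΦ : Φ ∈ schwartzBruhatAdelicMatrix n K) (hΦc : Continuous Φ)
    {β : (AdelicGroupData.gl n K).Adelic → ℝ}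
    (hβ : IsBruhatFunction (AdelicGroupData.gl n K).quotientSubgroup (quotientSubgroupHaar n K) β)
    {α : Measure (AdelicGroupData.gl n K).center'} [α.IsHaarMeasure] {κ : ℝ≥0} (hκ0 : 0 < κ)
    (hκ : (quotientSubgroupHaar n K).map (quotientSubgroupEquiv n K) =
      κ • α.prod (count : Measure (AdelicGroupData.gl n K).arithmeticSubgroup))
    {F : (AdelicGroupData.gl n K).automorphicQuotient → ℂ} (hFX : Continuous F)
    (hFcusp : ∀ k, 0 < k → k < n → CuspConditionGL n K (invQuot (AdelicGroupData.gl n K) F) k)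
    (hfin : ∫⁻ y₀, ENNReal.ofReal (β y₀) * ((‖F (QuotientGroup.mk y₀)‖ₑ : ℝ≥0∞) *
      truncThetaMajorant Φ s x₀ α y₀) ∂ν < ⊤) :
    ∫ y₀ : (AdelicGroupData.gl n K).Adelic, (β y₀ : ℂ) * (F (QuotientGroup.mk y₀) *
      ∫ a : (AdelicGroupData.gl n K).center', (∑' ξ : SingR n K,
        singTermR x₀ s Φ ((a : (AdelicGroupData.gl n K).Adelic) * y₀⁻¹) ξ) ∂α) ∂ν = 0 := by
  haveI : Countable (SingR n K) := countable_singR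
  have hmk : Continuous fun y : (AdelicGroupData.gl n K).Adelic => F (QuotientGroup.mk y) :=
    hFX.comp (AdelicGroupData.gl n K).continuous_toAutomorphicQuotient
  have hψc : Continuous (invQuot (AdelicGroupData.gl n K) F) :=
    hFX.comp ((AdelicGroupData.gl n K).continuous_toAutomorphicQuotient.comp continuous_inv)
  have hψinv : ∀ γ ∈ (AdelicGroupData.gl n K).arithmeticSubgroup, ∀ y,
      invQuot (AdelicGroupData.gl n K) F (γ * y) = invQuot (AdelicGroupData.gl n K) F y :=
    fun γ hγ y => isLeftInvariant_invQuot (AdelicGroupData.gl n K) F γ hγ y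
  have hσm : Measurable fun z : (AdelicGroupData.gl n K).Adelic => ∑' ξ : SingR n K, singTermR x₀ s Φ z ξ :=
    Measurable.tsum fun ξ => measurable_singTermR x₀ s hΦc ξ
  have hSm : Measurable fun z : (AdelicGroupData.gl n K).Adelic => ∑' ξ : SingR n K, (‖singTermR x₀ s Φ z ξ‖ₑ : ℝ≥0∞) :=
    Measurable.tsum fun ξ => (measurable_singTermR x₀ s hΦc ξ).enorm
  -- absorb the central integral
  have hGEN := integral_bruhat_mul_integral_center_eq ν hκ0.ne' hβ hmk hσm
    (lt_of_le_of_lt (lintegral_mono fun y₀ => mul_le_mul_right (mul_le_mul_right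
      ((lintegral_mono fun a => enorm_tsum_le_tsum_enorm).trans (lintegral_center_tsum_singTermR_le x₀ s Φ y₀)) _) _) hfin)
  rw [hGEN]
  -- the covering-weight integral vanishes
  have hwm : Measurable (gjWeight κ α β) := measurable_gjWeight hβ.continuous
  have hww : ∀ y, coveringSum (AdelicGroupData.gl n K).arithmeticSubgroup (gjWeight κ α β) y = 1 :=
    coveringSum_gjWeight_eq_one hκ hβ
  have hint : ∫⁻ y, gjWeight κ α β y * ‖invQuot (AdelicGroupData.gl n K) F y‖ₑ *
      ∑' ξ : SingR n K, (‖singTermR x₀ s Φ y ξ‖ₑ : ℝ≥0∞) ∂ν < ⊤ := by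
    simp_rw [mul_assoc]
    rw [lintegral_gjWeight_mul_eq ν κ hβ.continuous hmk hSm]
    refine ENNReal.mul_lt_top ENNReal.coe_lt_top (lt_of_le_of_lt (lintegral_mono fun y₀ => ?_) hfin)
    exact mul_le_mul_right (mul_le_mul_right (lintegral_center_tsum_singTermR_le x₀ s Φ y₀) _) _
  have hB4 := integral_wt_mul_tsum_singTermR_eq_zero ν x₀ s hΦ hΦc hwm hww hψc hψinv hFcusp hint
  simp only [wt, Complex.real_smul] at hB4
  rw [hB4, mul_zero]

/-- **The `Φ̂`-side `ξ ≠ 0` piece vanishes** (dual majorant; `α` inversion invariant). [folklore] -/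
theorem integral_bruhat_mul_tsum_singTermL_eq_zero (x₀ : (AdelicGroupData.gl n K).Adelic) (s : ℂ)
    {Ψ : Matrix (Fin n) (Fin n) (AdeleRing (𝓞 K) K) → ℂ} (hΨ : Ψ ∈ schwartzBruhatAdelicMatrix n K) (hΨc : Continuous Ψ)
    {β : (AdelicGroupData.gl n K).Adelic → ℝ}
    (hβ : IsBruhatFunction (AdelicGroupData.gl n K).quotientSubgroup (quotientSubgroupHaar n K) β)
    {α : Measure (AdelicGroupData.gl n K).center'} [α.IsHaarMeasure] [α.IsInvInvariant] {κ : ℝ≥0} (hκ0 : 0 < κ)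
    (hκ : (quotientSubgroupHaar n K).map (quotientSubgroupEquiv n K) =
      κ • α.prod (count : Measure (AdelicGroupData.gl n K).arithmeticSubgroup))
    {F : (AdelicGroupData.gl n K).automorphicQuotient → ℂ} (hFX : Continuous F)
    (hFcusp : ∀ k, 0 < k → k < n → CuspConditionGL n K (invQuot (AdelicGroupData.gl n K) F) k)
    (hfin : ∫⁻ y₀, ENNReal.ofReal (β y₀) * ((‖F (QuotientGroup.mk y₀)‖ₑ : ℝ≥0∞) *
      dualThetaMajorant Ψ s x₀ α y₀) ∂ν < ⊤) :
    ∫ y₀ : (AdelicGroupData.gl n K).Adelic, (β y₀ : ℂ) * (F (QuotientGroup.mk y₀) *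
      ∫ a : (AdelicGroupData.gl n K).center', (∑' ξ : SingL n K,
        singTermL x₀ s Ψ ((a : (AdelicGroupData.gl n K).Adelic) * y₀⁻¹) ξ) ∂α) ∂ν = 0 := by
  haveI : Countable (SingL n K) := countable_singL
  have hmk : Continuous fun y : (AdelicGroupData.gl n K).Adelic => F (QuotientGroup.mk y) :=
    hFX.comp (AdelicGroupData.gl n K).continuous_toAutomorphicQuotient
  have hψc : Continuous (invQuot (AdelicGroupData.gl n K) F) :=
    hFX.comp ((AdelicGroupData.gl n K).continuous_toAutomorphicQuotient.comp continuous_inv)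
  have hψinv : ∀ γ ∈ (AdelicGroupData.gl n K).arithmeticSubgroup, ∀ y,
      invQuot (AdelicGroupData.gl n K) F (γ * y) = invQuot (AdelicGroupData.gl n K) F y :=
    fun γ hγ y => isLeftInvariant_invQuot (AdelicGroupData.gl n K) F γ hγ y
  have hσm : Measurable fun z : (AdelicGroupData.gl n K).Adelic => ∑' ξ : SingL n K, singTermL x₀ s Ψ z ξ :=
    Measurable.tsum fun ξ => measurable_singTermL x₀ s hΨc ξ
  have hSm : Measurable fun z : (AdelicGroupData.gl n K).Adelic => ∑' ξ : SingL n K, (‖singTermL x₀ s Ψ z ξ‖ₑ : ℝ≥0∞) :=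
    Measurable.tsum fun ξ => (measurable_singTermL x₀ s hΨc ξ).enorm
  have hGEN := integral_bruhat_mul_integral_center_eq ν hκ0.ne' hβ hmk hσm
    (lt_of_le_of_lt (lintegral_mono fun y₀ => mul_le_mul_right (mul_le_mul_right
      ((lintegral_mono fun a => enorm_tsum_le_tsum_enorm).trans (lintegral_center_tsum_singTermL_le x₀ s Ψ y₀)) _) _) hfin)
  rw [hGEN]
  have hwm : Measurable (gjWeight κ α β) := measurable_gjWeight hβ.continuous
  have hww : ∀ y, coveringSum (AdelicGroupData.gl n K).arithmeticSubgroup (gjWeight κ α β) y = 1 :=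
    coveringSum_gjWeight_eq_one hκ hβ
  have hint : ∫⁻ y, gjWeight κ α β y * ‖invQuot (AdelicGroupData.gl n K) F y‖ₑ *
      ∑' ξ : SingL n K, (‖singTermL x₀ s Ψ y ξ‖ₑ : ℝ≥0∞) ∂ν < ⊤ := by
    simp_rw [mul_assoc]
    rw [lintegral_gjWeight_mul_eq ν κ hβ.continuous hmk hSm]
    refine ENNReal.mul_lt_top ENNReal.coe_lt_top (lt_of_le_of_lt (lintegral_mono fun y₀ => ?_) hfin)
    exact mul_le_mul_right (mul_le_mul_right (lintegral_center_tsum_singTermL_le x₀ s Ψ y₀) _) _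
  have hB4 := integral_wt_mul_tsum_singTermL_eq_zero ν x₀ s hΨ hΨc hwm hww hψc hψinv hFcusp hint
  simp only [wt, Complex.real_smul] at hB4
  rw [hB4, mul_zero]

end Pieces

/-! ### The main vanishing theorem -/

section Main

variable [MeasurableSpace (AdeleRing (𝓞 K) K)] [BorelSpace (AdeleRing (𝓞 K) K)]
  [MeasurableSpace (Matrix (Fin n) (Fin n) (AdeleRing (𝓞 K) K))]
  [BorelSpace (Matrix (Fin n) (Fin n) (AdeleRing (𝓞 K) K))]
  (lam : Measure (Matrix (Fin n) (Fin n) (AdeleRing (𝓞 K) K))) [lam.IsAddHaarMeasure]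
  (μ : Measure (AdelicGroupData.gl n K).automorphicQuotient)
  [(AdelicGroupData.gl n K).IsAutomorphicMeasure μ]
  (ν : Measure (AdelicGroupData.gl n K).Adelic) [ν.IsHaarMeasure]

/-- **The singular defect of the reflection formula integrates to zero against a cusp form, for every
fixed outer variable `x₀`.** Let `n ≥ 1`, `Φ ∈ 𝒮(M_n(𝔸_K))`, `Re s ≥ n² + n + 2`, `β` a Bruhat
function of `H = A_G GL_n(K)` with `ρ_H ≅ κ (α ⊗ #)` (`α` an inversion invariant Haar measure on
`A_G ≅ ℝ_{>0}`, `α ↦ c_α · Lebesgue`), and `F : X → ℂ` continuous and integrable with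
`∫_X F dμ = 0`, `F([g⁻¹])` rapidly decreasing on Siegel sets and satisfying the cusp conditions along
all proper maximal parabolics (e.g. a smoothed cusp form). Then

  `∫_G β(y₀) (κ ∫_{A_G} (Q' - Q)(x₀, y₀, a) dα) F([y₀]) dν(y₀) = 0`,

`Q' - Q = gjSingDefect` the singular defect of `gjZeta_restrict_compl_sub_dual_eq_integral_gjSingDefect`.
Proof (Godement–Jacquet (1972), §12, pp. 164–166, in the tree's formalism): the defect is
`λ⁻¹ F''((a y₀⁻¹)⁻¹ x₀⁻¹) Θ_{Φ̂}^sing - F₁(x₀ a y₀⁻¹) Θ_Φ^sing`; each `Θ^sing` is `Φ(0)` plus the sum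
over the non-zero singular `ξ`; the `ξ = 0` terms contribute constants (`c_α/s`, `-c_α/(n-s)`,
`GodementJacquetCenterMellin`) times `∫ β F∘π dν = c⁻¹ ∫_X F dμ = 0`; the `ξ ≠ 0` terms are
absolutely convergent (`GodementJacquetSingularIntegrability`), become after absorbing the
`A_G`-integral (`integral_bruhat_mul_integral_center_eq`) integrals against the covering weight
`gjWeight`, and vanish by cuspidality (`integral_wt_mul_tsum_singTermR_eq_zero`,
`integral_wt_mul_tsum_singTermL_eq_zero`). [cite: GodementJacquetLNM260, §12] -/
theorem integral_bruhat_mul_singDefect_eq_zero (hn : 0 < n)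
    {Φ : Matrix (Fin n) (Fin n) (AdeleRing (𝓞 K) K) → ℂ} (hΦ : Φ ∈ schwartzBruhatAdelicMatrix n K)
    (x₀ : (AdelicGroupData.gl n K).Adelic) {s : ℂ} (hs : (n : ℝ) * n + n + 2 ≤ s.re)
    {β : (AdelicGroupData.gl n K).Adelic → ℝ}
    (hβ : IsBruhatFunction (AdelicGroupData.gl n K).quotientSubgroup (quotientSubgroupHaar n K) β)
    {α : Measure (AdelicGroupData.gl n K).center'} [α.IsHaarMeasure] [α.IsInvInvariant] {κ : ℝ≥0} (hκ0 : 0 < κ)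
    (hκ : (quotientSubgroupHaar n K).map (quotientSubgroupEquiv n K) =
      κ • α.prod (count : Measure (AdelicGroupData.gl n K).arithmeticSubgroup))
    {cα : ℝ≥0} (hα : α.map (centerLog n K hn) = cα • (volume : Measure ℝ))
    {F : (AdelicGroupData.gl n K).automorphicQuotient → ℂ} (hFX : Continuous F) (hFint : Integrable F μ)
    (hF0 : ∫ x, F x ∂μ = 0)
    (hFd : IsRapidlyDecreasingGL n K (invQuot (AdelicGroupData.gl n K) F))
    (hFcusp : ∀ k, 0 < k → k < n → CuspConditionGL n K (invQuot (AdelicGroupData.gl n K) F) k) :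
    ∫ y₀ : (AdelicGroupData.gl n K).Adelic, (β y₀ : ℂ) *
      ((((κ : ℝ) • ∫ a, gjSingDefect lam Φ s x₀ y₀ a ∂α)) *
        F (QuotientGroup.mk y₀)) ∂ν = 0 := by
  haveI : NeZero n := ⟨hn.ne'⟩
  haveI : Countable (SingR n K) := countable_singR
  haveI : Countable (SingL n K) := countable_singL
  -- abscissae
  have hn1 : (1 : ℝ) ≤ n := by exact_mod_cast hn
  have hsT : (n : ℝ) + 1 < s.re := by nlinarith
  have hsD : 2 * (n : ℝ) + 1 < s.re := by nlinarith
  have hs0 : 0 < s.re := by linarith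
  have hw : ((n : ℂ) - s).re < 0 := by
    simp only [Complex.sub_re, Complex.natCast_re]; linarith
  -- the two test functions and their continuity
  set Ψ : Matrix (Fin n) (Fin n) (AdeleRing (𝓞 K) K) → ℂ := adelicMatrixFourier n K lam Φ with hΨdef
  have hΨ : Ψ ∈ schwartzBruhatAdelicMatrix n K := adelicMatrixFourier_mem_schwartzBruhatAdelicMatrix lam hΦ
  have hΦc : Continuous Φ := continuous_of_mem_schwartzBruhatAdelicMatrix' hΦ
  have hΨc : Continuous Ψ := continuous_of_mem_schwartzBruhatAdelicMatrix' hΨ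
  -- the cusp form on the group
  set ψ : (AdelicGroupData.gl n K).Adelic → ℂ := invQuot (AdelicGroupData.gl n K) F with hψdef
  have hψc : Continuous ψ := hFX.comp ((AdelicGroupData.gl n K).continuous_toAutomorphicQuotient.comp continuous_inv)
  have hψinv : ∀ γ ∈ (AdelicGroupData.gl n K).arithmeticSubgroup, ∀ y, ψ (γ * y) = ψ y :=
    fun γ hγ y => isLeftInvariant_invQuot (AdelicGroupData.gl n K) F γ hγ y
  have hmk : Continuous fun y : (AdelicGroupData.gl n K).Adelic => F (QuotientGroup.mk y) :=
    hFX.comp (AdelicGroupData.gl n K).continuous_toAutomorphicQuotient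
  -- the weight
  set w : (AdelicGroupData.gl n K).Adelic → ℝ≥0∞ := gjWeight κ α β with hwdef
  have hwm : Measurable w := measurable_gjWeight hβ.continuous
  have hww : ∀ y, coveringSum (AdelicGroupData.gl n K).arithmeticSubgroup w y = 1 :=
    coveringSum_gjWeight_eq_one hκ hβ
  -- the four pieces `σ`
  set L : ℂ := ((lam (matrixFundamentalDomain n K)).toReal : ℂ)⁻¹ with hL
  set σT0 : (AdelicGroupData.gl n K).Adelic → ℂ := fun z =>
    gjTruncF n K (fun _ => (1 : ℂ)) s (x₀ * z) * Φ 0 with hσT0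
  set σT1 : (AdelicGroupData.gl n K).Adelic → ℂ := fun z => ∑' ξ : SingR n K, singTermR x₀ s Φ z ξ with hσT1
  set σD0 : (AdelicGroupData.gl n K).Adelic → ℂ := fun z =>
    gjDualF n K (fun _ => (1 : ℂ)) ((n : ℂ) - s) (z⁻¹ * x₀⁻¹) * Ψ 0 with hσD0
  set σD1 : (AdelicGroupData.gl n K).Adelic → ℂ := fun z => ∑' ξ : SingL n K, singTermL x₀ s Ψ z ξ with hσD1
  have hdefect : ∀ (y₀ : (AdelicGroupData.gl n K).Adelic) (a : (AdelicGroupData.gl n K).center'),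
      gjSingDefect lam Φ s x₀ y₀ a =
        L * (σD0 ((a : (AdelicGroupData.gl n K).Adelic) * y₀⁻¹) + σD1 ((a : (AdelicGroupData.gl n K).Adelic) * y₀⁻¹)) -
          (σT0 ((a : (AdelicGroupData.gl n K).Adelic) * y₀⁻¹) + σT1 ((a : (AdelicGroupData.gl n K).Adelic) * y₀⁻¹)) := by
    intro y₀ a
    have hinv : ((a : (AdelicGroupData.gl n K).Adelic) * y₀⁻¹)⁻¹ = y₀ * ((a : (AdelicGroupData.gl n K).Adelic))⁻¹ := by
      rw [mul_inv_rev, inv_inv]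
    simp only [gjSingDefect, hσT0, hσT1, hσD0, hσD1, singTermR, singTermL, hinv, ← mul_assoc,
      tsum_mul_left, ← mul_add, ← hΨdef, ← hL]
    rw [gjThetaSing_eq_apply_zero_add_tsum' hn hΨ, gjThetaSing_eq_apply_zero_add_tsum hn hΦ]
    rfl
  -- the `ξ = 0` pieces: integrable in `a` with constant integrals
  have hT0 : ∀ y₀ : (AdelicGroupData.gl n K).Adelic,
      Integrable (fun a : (AdelicGroupData.gl n K).center' => σT0 ((a : (AdelicGroupData.gl n K).Adelic) * y₀⁻¹)) α ∧
        ∫ a : (AdelicGroupData.gl n K).center', σT0 ((a : (AdelicGroupData.gl n K).Adelic) * y₀⁻¹) ∂α = (cα : ℂ) / s * Φ 0 := by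
    intro y₀
    obtain ⟨hI, hV⟩ := integrable_and_integral_gjTruncF_one_center hn hα hs0 x₀ y₀⁻¹
    have heq : (fun a : (AdelicGroupData.gl n K).center' => σT0 ((a : (AdelicGroupData.gl n K).Adelic) * y₀⁻¹)) =
        fun a : (AdelicGroupData.gl n K).center' =>
          gjTruncF n K (fun _ => (1 : ℂ)) s (x₀ * (a : (AdelicGroupData.gl n K).Adelic) * y₀⁻¹) * Φ 0 := by
      funext a; simp only [hσT0, ← mul_assoc]
    rw [heq]
    exact ⟨hI.mul_const _, by rw [integral_mul_const, hV]⟩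
  have hD0 : ∀ y₀ : (AdelicGroupData.gl n K).Adelic,
      Integrable (fun a : (AdelicGroupData.gl n K).center' => σD0 ((a : (AdelicGroupData.gl n K).Adelic) * y₀⁻¹)) α ∧
        ∫ a : (AdelicGroupData.gl n K).center', σD0 ((a : (AdelicGroupData.gl n K).Adelic) * y₀⁻¹) ∂α =
          -(cα : ℂ) / ((n : ℂ) - s) * Ψ 0 := by
    intro y₀
    obtain ⟨hI, hV⟩ := integrable_and_integral_gjDualF_one_center hn hα hw y₀ x₀⁻¹
    have heq : (fun a : (AdelicGroupData.gl n K).center' => σD0 ((a : (AdelicGroupData.gl n K).Adelic) * y₀⁻¹)) =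
        fun a : (AdelicGroupData.gl n K).center' => gjDualF n K (fun _ => (1 : ℂ)) ((n : ℂ) - s)
          (y₀ * ((a⁻¹ : (AdelicGroupData.gl n K).center') : (AdelicGroupData.gl n K).Adelic) * x₀⁻¹) * Ψ 0 := by
      funext a; simp only [hσD0, mul_inv_rev, inv_inv, Subgroup.coe_inv]
    rw [heq]
    refine ⟨(hI.comp_inv).mul_const _, ?_⟩
    rw [integral_mul_const, ← hV, ← integral_inv_eq_self (μ := α) (fun a : (AdelicGroupData.gl n K).center' =>
      gjDualF n K (fun _ => (1 : ℂ)) ((n : ℂ) - s) (y₀ * (a : (AdelicGroupData.gl n K).Adelic) * x₀⁻¹))]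
  -- finiteness of the majorant integrals and the a.e. finiteness sets
  have hfinT := lintegral_bruhat_enorm_mul_truncThetaMajorant_lt_top μ ν hn hΦ x₀ hsT hα hβ hψc hFd
  have hfinD := lintegral_bruhat_enorm_mul_dualThetaMajorant_lt_top μ ν hn hΨ x₀ hsD hα hβ hψc hFd
  have haeT : ∀ᵐ y₀ ∂ν, ENNReal.ofReal (β y₀) * ((‖F (QuotientGroup.mk y₀)‖ₑ : ℝ≥0∞) * truncThetaMajorant Φ s x₀ α y₀) < ⊤ :=
    ae_lt_top (hβ.continuous.measurable.ennreal_ofReal.mul (hmk.measurable.enorm.mul (measurable_truncThetaMajorant hΦc))) hfinT.ne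
  have haeD : ∀ᵐ y₀ ∂ν, ENNReal.ofReal (β y₀) * ((‖F (QuotientGroup.mk y₀)‖ₑ : ℝ≥0∞) * dualThetaMajorant Ψ s x₀ α y₀) < ⊤ :=
    ae_lt_top (hβ.continuous.measurable.ennreal_ofReal.mul (hmk.measurable.enorm.mul (measurable_dualThetaMajorant hΨc))) hfinD.ne
  -- measurability of the `ξ ≠ 0` pieces
  have hσT1m : Measurable σT1 := Measurable.tsum fun ξ => measurable_singTermR x₀ s hΦc ξ
  have hσD1m : Measurable σD1 := Measurable.tsum fun ξ => measurable_singTermL x₀ s hΨc ξ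
  have hact : Measurable fun p : (AdelicGroupData.gl n K).Adelic × (AdelicGroupData.gl n K).center' =>
      (p.2 : (AdelicGroupData.gl n K).Adelic) * p.1⁻¹ :=
    ((continuous_subtype_val.comp continuous_snd).mul continuous_fst.inv).measurable
  have hT1le : ∀ y₀ : (AdelicGroupData.gl n K).Adelic, ∫⁻ a : (AdelicGroupData.gl n K).center',
      ‖σT1 ((a : (AdelicGroupData.gl n K).Adelic) * y₀⁻¹)‖ₑ ∂α ≤ truncThetaMajorant Φ s x₀ α y₀ := fun y₀ =>
    (lintegral_mono fun a => enorm_tsum_le_tsum_enorm).trans (lintegral_center_tsum_singTermR_le x₀ s Φ y₀)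
  have hD1le : ∀ y₀ : (AdelicGroupData.gl n K).Adelic, ∫⁻ a : (AdelicGroupData.gl n K).center',
      ‖σD1 ((a : (AdelicGroupData.gl n K).Adelic) * y₀⁻¹)‖ₑ ∂α ≤ dualThetaMajorant Ψ s x₀ α y₀ := fun y₀ =>
    (lintegral_mono fun a => enorm_tsum_le_tsum_enorm).trans (lintegral_center_tsum_singTermL_le x₀ s Ψ y₀)
  -- the pieces `G`, as functions of `y₀`
  set B : (AdelicGroupData.gl n K).Adelic → ℂ := fun y₀ => (β y₀ : ℂ) * F (QuotientGroup.mk y₀) with hB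
  set GT1 : (AdelicGroupData.gl n K).Adelic → ℂ := fun y₀ => (β y₀ : ℂ) * (F (QuotientGroup.mk y₀) *
    ∫ a : (AdelicGroupData.gl n K).center', σT1 ((a : (AdelicGroupData.gl n K).Adelic) * y₀⁻¹) ∂α) with hGT1
  set GD1 : (AdelicGroupData.gl n K).Adelic → ℂ := fun y₀ => (β y₀ : ℂ) * (F (QuotientGroup.mk y₀) *
    ∫ a : (AdelicGroupData.gl n K).center', σD1 ((a : (AdelicGroupData.gl n K).Adelic) * y₀⁻¹) ∂α) with hGD1
  -- the pointwise identity, a.e.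
  have hpt : ∀ᵐ y₀ ∂ν, (β y₀ : ℂ) * ((((κ : ℝ) • ∫ a, gjSingDefect lam Φ s x₀ y₀ a ∂α)) * F (QuotientGroup.mk y₀)) =
      (κ : ℂ) * (L * (B y₀ * (-(cα : ℂ) / ((n : ℂ) - s) * Ψ 0) + GD1 y₀) - (B y₀ * ((cα : ℂ) / s * Φ 0) + GT1 y₀)) := by
    filter_upwards [haeT, haeD] with y₀ hyT hyD
    by_cases hzero : B y₀ = 0
    · have hz : ∀ I : ℂ, (β y₀ : ℂ) * (F (QuotientGroup.mk y₀) * I) = 0 := fun I => by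
        rw [← mul_assoc]; exact mul_eq_zero_of_left hzero I
      have hz' : (β y₀ : ℂ) * ((((κ : ℝ) • ∫ a, gjSingDefect lam Φ s x₀ y₀ a ∂α)) * F (QuotientGroup.mk y₀)) = 0 := by
        rw [mul_comm (((κ : ℝ) • ∫ a, gjSingDefect lam Φ s x₀ y₀ a ∂α))]; exact hz _
      simp only [hGT1, hGD1, hz, hz', hzero, zero_mul, add_zero, mul_zero, sub_zero]
    · -- the majorants are finite at `y₀`
      have hB0 : ENNReal.ofReal (β y₀) * (‖F (QuotientGroup.mk y₀)‖ₑ : ℝ≥0∞) ≠ 0 := by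
        have hβ0 : β y₀ ≠ 0 := fun h => hzero (by simp only [hB, h, Complex.ofReal_zero, zero_mul])
        have hF0' : F (QuotientGroup.mk y₀) ≠ 0 := fun h => hzero (by rw [hB]; exact mul_eq_zero_of_right _ h)
        exact mul_ne_zero (ENNReal.ofReal_pos.2 (lt_of_le_of_ne (hβ.nonneg _) (Ne.symm hβ0))).ne' (enorm_ne_zero.2 hF0')
      have hKT : truncThetaMajorant Φ s x₀ α y₀ < ⊤ :=
        ENNReal.lt_top_of_mul_ne_top_right (by rw [mul_assoc]; exact hyT.ne) hB0
      have hKD : dualThetaMajorant Ψ s x₀ α y₀ < ⊤ :=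
        ENNReal.lt_top_of_mul_ne_top_right (by rw [mul_assoc]; exact hyD.ne) hB0
      have hiT1 : Integrable (fun a : (AdelicGroupData.gl n K).center' => σT1 ((a : (AdelicGroupData.gl n K).Adelic) * y₀⁻¹)) α :=
        ⟨(hσT1m.comp ((continuous_subtype_val.mul continuous_const).measurable)).aestronglyMeasurable,
          (hT1le y₀).trans_lt hKT⟩
      have hiD1 : Integrable (fun a : (AdelicGroupData.gl n K).center' => σD1 ((a : (AdelicGroupData.gl n K).Adelic) * y₀⁻¹)) α :=
        ⟨(hσD1m.comp ((continuous_subtype_val.mul continuous_const).measurable)).aestronglyMeasurable,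
          (hD1le y₀).trans_lt hKD⟩
      have hIS : ∫ a, gjSingDefect lam Φ s x₀ y₀ a ∂α =
          L * (-(cα : ℂ) / ((n : ℂ) - s) * Ψ 0 + ∫ a : (AdelicGroupData.gl n K).center', σD1 ((a : (AdelicGroupData.gl n K).Adelic) * y₀⁻¹) ∂α) -
            ((cα : ℂ) / s * Φ 0 + ∫ a : (AdelicGroupData.gl n K).center', σT1 ((a : (AdelicGroupData.gl n K).Adelic) * y₀⁻¹) ∂α) := by
        simp_rw [hdefect y₀]
        have e1 : ∫ a : (AdelicGroupData.gl n K).center',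
            (L * (σD0 ((a : (AdelicGroupData.gl n K).Adelic) * y₀⁻¹) + σD1 ((a : (AdelicGroupData.gl n K).Adelic) * y₀⁻¹)) -
              (σT0 ((a : (AdelicGroupData.gl n K).Adelic) * y₀⁻¹) + σT1 ((a : (AdelicGroupData.gl n K).Adelic) * y₀⁻¹))) ∂α =
            (∫ a : (AdelicGroupData.gl n K).center',
              L * (σD0 ((a : (AdelicGroupData.gl n K).Adelic) * y₀⁻¹) + σD1 ((a : (AdelicGroupData.gl n K).Adelic) * y₀⁻¹)) ∂α) -
            ∫ a : (AdelicGroupData.gl n K).center',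
              (σT0 ((a : (AdelicGroupData.gl n K).Adelic) * y₀⁻¹) + σT1 ((a : (AdelicGroupData.gl n K).Adelic) * y₀⁻¹)) ∂α :=
          integral_sub (((hD0 y₀).1.add hiD1).const_mul L) ((hT0 y₀).1.add hiT1)
        have e2 : ∫ a : (AdelicGroupData.gl n K).center',
            L * (σD0 ((a : (AdelicGroupData.gl n K).Adelic) * y₀⁻¹) + σD1 ((a : (AdelicGroupData.gl n K).Adelic) * y₀⁻¹)) ∂α =
            L * ((∫ a : (AdelicGroupData.gl n K).center', σD0 ((a : (AdelicGroupData.gl n K).Adelic) * y₀⁻¹) ∂α) +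
              ∫ a : (AdelicGroupData.gl n K).center', σD1 ((a : (AdelicGroupData.gl n K).Adelic) * y₀⁻¹) ∂α) := by
          rw [integral_const_mul, integral_add (hD0 y₀).1 hiD1]
        have e3 : ∫ a : (AdelicGroupData.gl n K).center',
            (σT0 ((a : (AdelicGroupData.gl n K).Adelic) * y₀⁻¹) + σT1 ((a : (AdelicGroupData.gl n K).Adelic) * y₀⁻¹)) ∂α =
            (∫ a : (AdelicGroupData.gl n K).center', σT0 ((a : (AdelicGroupData.gl n K).Adelic) * y₀⁻¹) ∂α) +
              ∫ a : (AdelicGroupData.gl n K).center', σT1 ((a : (AdelicGroupData.gl n K).Adelic) * y₀⁻¹) ∂α :=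
          integral_add (hT0 y₀).1 hiT1
        rw [e1, e2, e3, (hD0 y₀).2, (hT0 y₀).2]
      rw [hIS]
      simp only [hB, hGT1, hGD1, Complex.real_smul]
      ring
  -- integrability of the pieces in `y₀`
  obtain ⟨hBi, -⟩ := integrable_bruhat_mul_comp_mk μ ν hβ hFX hFint
  have hB0int : ∫ y₀, B y₀ ∂ν = 0 := by
    have h := integral_bruhat_mul_comp_mk_eq μ ν hβ hFint
    rw [hF0, mul_zero] at h
    exact h
  have hGi : ∀ {σ : (AdelicGroupData.gl n K).Adelic → ℂ} (hσ : Measurable σ) {M : (AdelicGroupData.gl n K).Adelic → ℝ≥0∞}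
      (hle : ∀ y₀, ∫⁻ a : (AdelicGroupData.gl n K).center', ‖σ ((a : (AdelicGroupData.gl n K).Adelic) * y₀⁻¹)‖ₑ ∂α ≤ M y₀)
      (hfin : ∫⁻ y₀, ENNReal.ofReal (β y₀) * ((‖F (QuotientGroup.mk y₀)‖ₑ : ℝ≥0∞) * M y₀) ∂ν < ⊤),
      Integrable (fun y₀ => (β y₀ : ℂ) * (F (QuotientGroup.mk y₀) *
        ∫ a : (AdelicGroupData.gl n K).center', σ ((a : (AdelicGroupData.gl n K).Adelic) * y₀⁻¹) ∂α)) ν := by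
    intro σ hσ M hle hfin
    have hIm : StronglyMeasurable fun y₀ : (AdelicGroupData.gl n K).Adelic =>
        ∫ a : (AdelicGroupData.gl n K).center', σ ((a : (AdelicGroupData.gl n K).Adelic) * y₀⁻¹) ∂α :=
      StronglyMeasurable.integral_prod_right' (f := fun p : (AdelicGroupData.gl n K).Adelic × (AdelicGroupData.gl n K).center' =>
        σ ((p.2 : (AdelicGroupData.gl n K).Adelic) * p.1⁻¹)) (hσ.comp hact).stronglyMeasurable
    refine ⟨((Complex.continuous_ofReal.comp hβ.continuous).measurable.mul (hmk.measurable.mul hIm.measurable)).aestronglyMeasurable, ?_⟩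
    rw [HasFiniteIntegral]
    refine lt_of_le_of_lt (lintegral_mono fun y₀ => ?_) hfin
    rw [enorm_mul, enorm_mul, ← ofReal_norm (β y₀ : ℂ), Complex.norm_real, Real.norm_of_nonneg (hβ.nonneg _)]
    exact mul_le_mul_right (mul_le_mul_right ((enorm_integral_le_lintegral_enorm _).trans (hle y₀)) _) _
  have hGT1i : Integrable GT1 ν := hGi hσT1m hT1le hfinT
  have hGD1i : Integrable GD1 ν := hGi hσD1m hD1le hfinD
  -- the `ξ ≠ 0` pieces vanish
  have hGT1z : ∫ y₀, GT1 y₀ ∂ν = 0 :=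
    integral_bruhat_mul_tsum_singTermR_eq_zero ν x₀ s hΦ hΦc hβ hκ0 hκ hFX hFcusp hfinT
  have hGD1z : ∫ y₀, GD1 y₀ ∂ν = 0 :=
    integral_bruhat_mul_tsum_singTermL_eq_zero ν x₀ s hΨ hΨc hβ hκ0 hκ hFX hFcusp hfinD
  -- conclusion
  have eS : ∫ y, (L * (B y * (-(cα : ℂ) / ((n : ℂ) - s) * Ψ 0) + GD1 y) - (B y * ((cα : ℂ) / s * Φ 0) + GT1 y)) ∂ν =
      (∫ y, L * (B y * (-(cα : ℂ) / ((n : ℂ) - s) * Ψ 0) + GD1 y) ∂ν) - ∫ y, (B y * ((cα : ℂ) / s * Φ 0) + GT1 y) ∂ν :=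
    integral_sub (((hBi.mul_const _).add hGD1i).const_mul L) ((hBi.mul_const _).add hGT1i)
  have eD : ∫ y, L * (B y * (-(cα : ℂ) / ((n : ℂ) - s) * Ψ 0) + GD1 y) ∂ν =
      L * ((∫ y, B y ∂ν) * (-(cα : ℂ) / ((n : ℂ) - s) * Ψ 0) + ∫ y, GD1 y ∂ν) := by
    rw [integral_const_mul, integral_add (hBi.mul_const _) hGD1i, integral_mul_const]
  have eT : ∫ y, (B y * ((cα : ℂ) / s * Φ 0) + GT1 y) ∂ν = (∫ y, B y ∂ν) * ((cα : ℂ) / s * Φ 0) + ∫ y, GT1 y ∂ν := by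
    rw [integral_add (hBi.mul_const _) hGT1i, integral_mul_const]
  rw [integral_congr_ae hpt, integral_const_mul, eS, eD, eT, hB0int, hGT1z, hGD1z]
  ring

end Main

end Literature.NumberTheory.Automorphic
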